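import Literature.NumberTheory.Sieve.FriedlanderIwaniecPrimesJacobiTwistedSymmetry
import Literature.NumberTheory.Sieve.FriedlanderIwaniecPrimesJacobiTwistedProp111
import HarnessLib

/-!
# Friedlander–Iwaniec, *The polynomial `X² + Y⁴` captures its primes*, §12: the reciprocity flip (12.2)

[FI, §12, p. 45 of arXiv:math/9811185 = Ann. of Math. 148 (1998), (12.1)–(12.2)]: "For technical
convenience we assume that our vectors `α = (α_{rs})` satisfy `(r, 2s) = 1`. Furthermore by splitting
into four residue classes we can assume without loss of generality that `r` is fixed modulo eight. We
have by the reciprocity law `(r/d') = ±(d/r)` where `±` depends on `d` and on `r (mod 8)` but not on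
`r` in any other fashion. Therefore `V(D)` for our vectors can be written as
`V(D) = ∑_{D<d≤2D} ∑_{a (mod d)} |∑_{r̄s ≡ a (mod d)} α_{rs} (d/r)|²`."

This file PROVES that reduction as a transfer principle (no definitions, no named facts):

* `jacobiSym_flip` — the reciprocity law in the form used: for `d ≥ 1` and odd `r`,
  `(d/r) = χ₈(r)^k · qrSign(r, d') · (r/d')` where `d = 2^k d'`, `d'` odd
  (`(r/d') = jtChar d r`); the sign depends on `d` and `r (mod 8)` only (`jacobiSym_flip_mod_eight`).
* `jtVflip_le_of_jtV_le` — **the flip**: if the tree's form `V(D) = jtV` (symbol `(r/d')`, (11.11))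
  obeys a bound `jtV D₁ D₂ R S β ≤ Δ ∑∑ w(r,s) |β_{rs}|²` for all `β` with a given support property, then
  for every `α` supported on odd `r` with that property the FLIPPED form (symbol `(d/r)`, (12.2)) obeys
  the same bound with constant `4Δ` (Cauchy–Schwarz over the four classes `r ≡ 1, 3, 5, 7 (mod 8)`).
* `exists_jtVflip_le` — Proposition 11.1 [FI, Prop. 11.1] for the flipped form, from the tree theorem
  `exists_jtV_le`.
* `jacobiSym_absDet_eq`, `jacobiSym_complementary_divisor` — the complementary-divisor identity before
  (12.10): `(dm/(r₁r₂)) = (s₁/r₁)(s₂/r₂)(q/(r₁r₂))` when `|r₁s₂ − r₂s₁| = dmq`.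

This is step 0 of the map of the proof of Proposition 12.1 (HOME/parity-ideate-lit/FI98-Prop121-MAP.md
of the Parity cell): Propositions 11.1* and 12.1 apply Proposition 11.1 in the flipped currency.
-/

noncomputable section

open Finset Real Complex
open scoped NumberTheorySymbols ArithmeticFunction.sigma Nat

namespace Literature.NumberTheory.Sieve.FriedlanderIwaniecPrimes

/-! ### The reciprocity flip for one symbol -/

/-- The odd part of `d ≠ 0` is odd. [folklore] -/
private theorem odd_ordCompl_two {d : ℕ} (hd : d ≠ 0) : Odd (ordCompl[2] d) := by
  rw [Nat.odd_iff]
  have h := Nat.coprime_ordCompl Nat.prime_two hd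
  have h2 : ¬ 2 ∣ ordCompl[2] d := by
    intro hdvd
    have := Nat.Coprime.eq_one_of_dvd (Nat.Coprime.symm h |>.symm) hdvd
    omega
  omega

/-- **The reciprocity law in FI's form** [FI, §12, before (12.2)]: for `d ≥ 1` and odd `r`,
`(d/r) = χ₈(r)^k · qrSign(r, d') · (r/d')` with `d = 2^k d'`, `d'` odd, where `(r/d') = jtChar d r`.
[cite: FriedlanderIwaniecAnnals1998, §12, (12.2)] -/
theorem jacobiSym_flip {d r : ℕ} (hd : d ≠ 0) (hr : Odd r) :
    J((d : ℤ) | r) = ZMod.χ₈ (r : ZMod 8) ^ (d.factorization 2) * qrSign r (ordCompl[2] d) *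
      jtChar d r := by
  have hsplit : (d : ℤ) = (2 : ℤ) ^ (d.factorization 2) * (ordCompl[2] d : ℕ) := by
    have h := Nat.ordProj_mul_ordCompl_eq_self d 2
    conv_lhs => rw [← h]
    push_cast
    ring
  have hodd : Odd (ordCompl[2] d) := odd_ordCompl_two hd
  rw [jtChar_def, hsplit, jacobiSym.mul_left, jacobiSym.pow_left, jacobiSym.at_two hr,
    jacobiSym.quadratic_reciprocity' hodd hr]
  ring

/-- The sign `χ₈(r)^k qrSign(r, d')` depends on `r` only through `r (mod 8)`. [folklore] -/
private theorem flipSign_mod_eight (d r : ℕ) :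
    ZMod.χ₈ (r : ZMod 8) ^ (d.factorization 2) * qrSign r (ordCompl[2] d) =
      ZMod.χ₈ ((r % 8 : ℕ) : ZMod 8) ^ (d.factorization 2) * qrSign (r % 8) (ordCompl[2] d) := by
  rw [ZMod.natCast_mod]
  congr 1
  simp only [qrSign]
  congr 2
  have h : ((r % 8 : ℕ) : ZMod 4) = (r : ZMod 4) := by
    rw [ZMod.natCast_eq_natCast_iff', Nat.mod_mod_of_dvd r (by norm_num : 4 ∣ 8)]
  rw [h]

/-- `jacobiSym_flip` with the sign written as a function of `r (mod 8)`.
[cite: FriedlanderIwaniecAnnals1998, §12, (12.2)] -/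
theorem jacobiSym_flip_mod_eight {d r : ℕ} (hd : d ≠ 0) (hr : Odd r) :
    J((d : ℤ) | r) = ZMod.χ₈ ((r % 8 : ℕ) : ZMod 8) ^ (d.factorization 2) *
      qrSign (r % 8) (ordCompl[2] d) * jtChar d r := by
  rw [jacobiSym_flip hd hr, flipSign_mod_eight]

/-- The sign has complex norm at most one. [folklore] -/
private theorem norm_flipSign_le_one (d c : ℕ) :
    ‖((ZMod.χ₈ ((c : ℕ) : ZMod 8) ^ (d.factorization 2) * qrSign c (ordCompl[2] d) : ℤ) : ℂ)‖ ≤ 1 := by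
  rw [Int.cast_mul, Int.cast_pow, norm_mul, norm_pow]
  have h1 : ‖((ZMod.χ₈ ((c : ℕ) : ZMod 8) : ℤ) : ℂ)‖ ≤ 1 := by
    rw [ZMod.χ₈_nat_eq_if_mod_eight]
    split_ifs <;> simp
  have h2 : ‖((qrSign c (ordCompl[2] d) : ℤ) : ℂ)‖ ≤ 1 := by
    have ht := jacobiSym.trichotomy (ZMod.χ₄ (c : ZMod 4)) (ordCompl[2] d)
    change qrSign c (ordCompl[2] d) = 0 ∨ qrSign c (ordCompl[2] d) = 1 ∨
      qrSign c (ordCompl[2] d) = -1 at ht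
    rcases ht with h | h | h <;> simp [h]
  calc ‖((ZMod.χ₈ ((c : ℕ) : ZMod 8) : ℤ) : ℂ)‖ ^ d.factorization 2 *
        ‖((qrSign c (ordCompl[2] d) : ℤ) : ℂ)‖
      ≤ 1 ^ d.factorization 2 * 1 := by
        gcongr
    _ = 1 := by simp

/-! ### The flip as a transfer principle -/

/-- For an odd `r`, `r % 8 ∈ {1, 3, 5, 7}`. [folklore] -/
private theorem mod_eight_mem_of_odd {r : ℕ} (hr : Odd r) : r % 8 ∈ ({1, 3, 5, 7} : Finset ℕ) := by
  simp only [mem_insert, mem_singleton]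
  rcases hr with ⟨k, rfl⟩
  omega

/-- **FI (12.2), the reciprocity flip as a transfer principle.** If `jtV` (symbol `(r/d')`) satisfies
`jtV D₁ D₂ R S β ≤ Δ ∑_r ∑_s w(r,s) |β_{rs}|²` for all `β` whose support has property `P`, then for
every `α` supported on odd `r` with property `P` the flipped form with symbol `(d/r)` satisfies the same
bound with `4Δ` ("by splitting into four residue classes … `r` fixed modulo eight … `(r/d') = ±(d/r)`").
[cite: FriedlanderIwaniecAnnals1998, §12, (12.1)–(12.2)] -/
theorem jtVflip_le_of_jtV_le {D₁ D₂ R S : ℕ} {Δ : ℝ} {w : ℕ → ℕ → ℝ} {P : ℕ → ℕ → Prop}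
    (hB : ∀ β : ℕ → ℕ → ℂ, (∀ r s, β r s ≠ 0 → P r s) →
      jtV D₁ D₂ R S β ≤ Δ * ∑ r ∈ Ioc R (2 * R), ∑ s ∈ Ioc S (2 * S), w r s * ‖β r s‖ ^ 2)
    {α : ℕ → ℕ → ℂ} (hP : ∀ r s, α r s ≠ 0 → P r s) (hodd : ∀ r s, α r s ≠ 0 → Odd r) :
    ∑ d ∈ Ioc D₁ D₂, ∑ a ∈ range d, ‖∑ r ∈ Ioc R (2 * R), ∑ s ∈ Ioc S (2 * S),
        (if r.Coprime d ∧ (d : ℤ) ∣ (s : ℤ) - (a : ℤ) * r then α r s * (J((d : ℤ) | r) : ℂ) else 0)‖ ^ 2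
      ≤ 4 * Δ * ∑ r ∈ Ioc R (2 * R), ∑ s ∈ Ioc S (2 * S), w r s * ‖α r s‖ ^ 2 := by
  classical
  -- the four classes and the restricted vectors
  set C : Finset ℕ := {1, 3, 5, 7} with hC
  have hCcard : #C = 4 := by rw [hC]; decide
  set αc : ℕ → ℕ → ℕ → ℂ := fun c r s => if r % 8 = c then α r s else 0 with hαc
  -- the sign
  set ε : ℕ → ℕ → ℂ := fun d c =>
    ((ZMod.χ₈ ((c : ℕ) : ZMod 8) ^ (d.factorization 2) * qrSign c (ordCompl[2] d) : ℤ) : ℂ) with hε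
  have hεle : ∀ d c, ‖ε d c‖ ≤ 1 := fun d c => norm_flipSign_le_one d c
  -- Step A: pointwise identity, for `d ≠ 0`
  have hptw : ∀ d : ℕ, d ≠ 0 → ∀ (a r s : ℕ),
      (if r.Coprime d ∧ (d : ℤ) ∣ (s : ℤ) - (a : ℤ) * r then α r s * (J((d : ℤ) | r) : ℂ) else 0) =
        ∑ c ∈ C, ε d c *
          (if r.Coprime d ∧ (d : ℤ) ∣ (s : ℤ) - (a : ℤ) * r then αc c r s * (jtChar d r : ℂ) else 0) := by
    intro d hd a r s
    by_cases hα : α r s = 0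
    · have h0 : ∀ c, αc c r s = 0 := fun c => by simp [hαc, hα]
      simp [hα, h0]
    have hr : Odd r := hodd r s hα
    have hmem : r % 8 ∈ C := mod_eight_mem_of_odd hr
    rw [Finset.sum_eq_single (r % 8)]
    · have hcc : αc (r % 8) r s = α r s := by simp [hαc]
      rw [hcc]
      split_ifs with hcond
      · rw [jacobiSym_flip_mod_eight hd hr]
        simp only [hε]
        push_cast
        ring
      · simp
    · intro c _ hc
      have : αc c r s = 0 := by
        simp only [hαc]
        rw [if_neg (Ne.symm hc)]
      simp [this]
    · intro h; exact absurd hmem h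
  -- Step B/C: the inner sums, class by class, and Cauchy–Schwarz over the four classes
  have hinner : ∀ d ∈ Ioc D₁ D₂, ∀ a : ℕ,
      ‖∑ r ∈ Ioc R (2 * R), ∑ s ∈ Ioc S (2 * S),
          (if r.Coprime d ∧ (d : ℤ) ∣ (s : ℤ) - (a : ℤ) * r then α r s * (J((d : ℤ) | r) : ℂ) else 0)‖ ^ 2
        ≤ 4 * ∑ c ∈ C, ‖∑ r ∈ Ioc R (2 * R), ∑ s ∈ Ioc S (2 * S),
          (if r.Coprime d ∧ (d : ℤ) ∣ (s : ℤ) - (a : ℤ) * r then αc c r s * (jtChar d r : ℂ) else 0)‖ ^ 2 := by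
    intro d hd a
    have hd0 : d ≠ 0 := by have := (mem_Ioc.1 hd).1; omega
    have hrew : ∑ r ∈ Ioc R (2 * R), ∑ s ∈ Ioc S (2 * S),
        (if r.Coprime d ∧ (d : ℤ) ∣ (s : ℤ) - (a : ℤ) * r then α r s * (J((d : ℤ) | r) : ℂ) else 0) =
        ∑ c ∈ C, ε d c * ∑ r ∈ Ioc R (2 * R), ∑ s ∈ Ioc S (2 * S),
          (if r.Coprime d ∧ (d : ℤ) ∣ (s : ℤ) - (a : ℤ) * r then αc c r s * (jtChar d r : ℂ) else 0) := by
      simp_rw [hptw d hd0 a, Finset.mul_sum]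
      calc _ = ∑ r ∈ Ioc R (2 * R), ∑ c ∈ C, ∑ s ∈ Ioc S (2 * S), ε d c *
            (if r.Coprime d ∧ (d : ℤ) ∣ (s : ℤ) - (a : ℤ) * r then αc c r s * (jtChar d r : ℂ) else 0) :=
            Finset.sum_congr rfl fun r _ => Finset.sum_comm
        _ = _ := Finset.sum_comm
    rw [hrew]
    calc ‖∑ c ∈ C, ε d c * ∑ r ∈ Ioc R (2 * R), ∑ s ∈ Ioc S (2 * S),
            (if r.Coprime d ∧ (d : ℤ) ∣ (s : ℤ) - (a : ℤ) * r then αc c r s * (jtChar d r : ℂ) else 0)‖ ^ 2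
        ≤ #C * ∑ c ∈ C, ‖ε d c * ∑ r ∈ Ioc R (2 * R), ∑ s ∈ Ioc S (2 * S),
            (if r.Coprime d ∧ (d : ℤ) ∣ (s : ℤ) - (a : ℤ) * r then αc c r s * (jtChar d r : ℂ) else 0)‖ ^ 2 :=
          norm_sum_sq_le_card_mul C _
      _ ≤ 4 * ∑ c ∈ C, ‖∑ r ∈ Ioc R (2 * R), ∑ s ∈ Ioc S (2 * S),
            (if r.Coprime d ∧ (d : ℤ) ∣ (s : ℤ) - (a : ℤ) * r then αc c r s * (jtChar d r : ℂ) else 0)‖ ^ 2 := by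
          rw [hCcard]
          push_cast
          gcongr with c hc
          rw [norm_mul]
          exact mul_le_of_le_one_left (norm_nonneg _) (hεle d c)
  -- Step D: sum over `d`, `a`: the flipped form is at most `4 ∑_c jtV(α_c)`
  have hD : ∑ d ∈ Ioc D₁ D₂, ∑ a ∈ range d, ‖∑ r ∈ Ioc R (2 * R), ∑ s ∈ Ioc S (2 * S),
        (if r.Coprime d ∧ (d : ℤ) ∣ (s : ℤ) - (a : ℤ) * r then α r s * (J((d : ℤ) | r) : ℂ) else 0)‖ ^ 2
      ≤ 4 * ∑ c ∈ C, jtV D₁ D₂ R S (αc c) := by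
    calc _ ≤ ∑ d ∈ Ioc D₁ D₂, ∑ a ∈ range d, 4 * ∑ c ∈ C, ‖∑ r ∈ Ioc R (2 * R), ∑ s ∈ Ioc S (2 * S),
          (if r.Coprime d ∧ (d : ℤ) ∣ (s : ℤ) - (a : ℤ) * r then αc c r s * (jtChar d r : ℂ) else 0)‖ ^ 2 :=
          Finset.sum_le_sum fun d hd => Finset.sum_le_sum fun a _ => hinner d hd a
      _ = 4 * ∑ c ∈ C, jtV D₁ D₂ R S (αc c) := by
          simp_rw [jtV_def, Finset.mul_sum]
          calc _ = ∑ d ∈ Ioc D₁ D₂, ∑ c ∈ C, ∑ a ∈ range d, 4 * ‖∑ r ∈ Ioc R (2 * R), ∑ s ∈ Ioc S (2 * S),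
                (if r.Coprime d ∧ (d : ℤ) ∣ (s : ℤ) - (a : ℤ) * r then αc c r s * (jtChar d r : ℂ)
                  else 0)‖ ^ 2 :=
                Finset.sum_congr rfl fun d _ => Finset.sum_comm
            _ = _ := Finset.sum_comm
  -- Step E: the hypothesis on each class
  have hE : ∀ c ∈ C, jtV D₁ D₂ R S (αc c) ≤
      Δ * ∑ r ∈ Ioc R (2 * R), ∑ s ∈ Ioc S (2 * S), w r s * ‖αc c r s‖ ^ 2 := by
    intro c _
    refine hB (αc c) fun r s h => hP r s ?_
    simp only [hαc] at h
    split_ifs at h with h8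
    · exact h
    · exact absurd rfl h
  -- Step F: the class norms add up
  have hF : ∑ c ∈ C, ∑ r ∈ Ioc R (2 * R), ∑ s ∈ Ioc S (2 * S), w r s * ‖αc c r s‖ ^ 2 =
      ∑ r ∈ Ioc R (2 * R), ∑ s ∈ Ioc S (2 * S), w r s * ‖α r s‖ ^ 2 := by
    rw [Finset.sum_comm]
    refine Finset.sum_congr rfl fun r _ => ?_
    rw [Finset.sum_comm]
    refine Finset.sum_congr rfl fun s _ => ?_
    rw [← Finset.mul_sum]
    congr 1
    by_cases hα : α r s = 0
    · have h0 : ∀ c, αc c r s = 0 := fun c => by simp [hαc, hα]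
      simp [hα, h0]
    · have hr : Odd r := hodd r s hα
      rw [Finset.sum_eq_single (r % 8)]
      · simp [hαc]
      · intro c _ hc
        have : αc c r s = 0 := by
          simp only [hαc]
          rw [if_neg (Ne.symm hc)]
        simp [this]
      · intro h; exact absurd (mod_eight_mem_of_odd hr) h
  -- assembly
  calc _ ≤ 4 * ∑ c ∈ C, jtV D₁ D₂ R S (αc c) := hD
    _ ≤ 4 * ∑ c ∈ C, Δ * ∑ r ∈ Ioc R (2 * R), ∑ s ∈ Ioc S (2 * S), w r s * ‖αc c r s‖ ^ 2 := by
        gcongr with c hc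
        exact hE c hc
    _ = 4 * Δ * ∑ r ∈ Ioc R (2 * R), ∑ s ∈ Ioc S (2 * S), w r s * ‖α r s‖ ^ 2 := by
        rw [← Finset.mul_sum, hF, mul_assoc]

/-- **Proposition 11.1 in the flipped currency (12.2)**: for every `ε > 0` there is `C > 0` such that
for `D, R, S ≥ 1` and every `α_{rs}` supported on odd `r`,
`∑_{D<d≤2D} ∑_{a (mod d)} |∑_{r̄s≡a (mod d)} α_{rs} (d/r)|² ≤ 4C {RS D^{-1/2} + (D√(RS) + RS^{3/4} + SR^{3/4})(RS)^ε} ∑|α_{rs}|²`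
— from the tree's Proposition 11.1 `exists_jtV_le` by `jtVflip_le_of_jtV_le`.
[cite: FriedlanderIwaniecAnnals1998, Proposition 11.1 and §12, (12.2)] -/
theorem exists_jtVflip_le {ε : ℝ} (hε : 0 < ε) :
    ∃ C : ℝ, 0 < C ∧ ∀ (D R S : ℕ) (α : ℕ → ℕ → ℂ), 1 ≤ D → 1 ≤ R → 1 ≤ S →
      (∀ r s, α r s ≠ 0 → Odd r) →
      ∑ d ∈ Ioc D (2 * D), ∑ a ∈ range d, ‖∑ r ∈ Ioc R (2 * R), ∑ s ∈ Ioc S (2 * S),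
          (if r.Coprime d ∧ (d : ℤ) ∣ (s : ℤ) - (a : ℤ) * r then α r s * (J((d : ℤ) | r) : ℂ) else 0)‖ ^ 2
        ≤ 4 * C * ((R : ℝ) * S / Real.sqrt D +
          ((D : ℝ) * Real.sqrt ((R : ℝ) * S) + (R : ℝ) * (S : ℝ) ^ (3 / 4 : ℝ) +
            (S : ℝ) * (R : ℝ) ^ (3 / 4 : ℝ)) * ((R : ℝ) * S) ^ ε) *
          ∑ r ∈ Ioc R (2 * R), ∑ s ∈ Ioc S (2 * S), ‖α r s‖ ^ 2 := by
  obtain ⟨C, hC, h⟩ := exists_jtV_le hε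
  refine ⟨C, hC, fun D R S α hD hR hS hodd => ?_⟩
  have key := jtVflip_le_of_jtV_le (P := fun _ _ => True) (w := fun _ _ => (1 : ℝ))
    (Δ := C * ((R : ℝ) * S / Real.sqrt D +
          ((D : ℝ) * Real.sqrt ((R : ℝ) * S) + (R : ℝ) * (S : ℝ) ^ (3 / 4 : ℝ) +
            (S : ℝ) * (R : ℝ) ^ (3 / 4 : ℝ)) * ((R : ℝ) * S) ^ ε))
    (by intro β _; simpa using h D R S β hD hR hS) (fun _ _ _ => trivial) hodd
  simpa [mul_assoc] using key

/-! ### The flip to the complementary divisor (the identity before (12.10))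

[FI, §12, p. 48]: "Here we flip `d` to the complementary divisor of `|r₁s₂ − r₂s₁| m⁻¹`. We write
`|r₁s₂ − r₂s₁| = dmq` … and using the reciprocity law we get (recall that `r₁, r₂` are co-prime, odd, and
congruent modulo eight) `(dm/(r₁r₂)) = (s₁/r₁)(s₂/r₂)(q/(r₁r₂))`." We prove it from `r₁ ≡ r₂ (mod 4)`
(which is what the argument uses) and the support condition `(rᵢ, sᵢ) = 1` of (12.1). -/

/-- `χ₄(r₁) (r₂/r₁)(r₁/r₂) = 1` for coprime odd `r₁ ≡ r₂ (mod 4)` — the reciprocity law in the shape used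
by the complementary-divisor flip. [cite: FriedlanderIwaniecAnnals1998, §12, before (12.10)] -/
theorem χ₄_mul_jacobiSym_mul_jacobiSym_eq_one {r₁ r₂ : ℕ} (hr₁ : Odd r₁) (hr₂ : Odd r₂)
    (hcop : r₁.Coprime r₂) (h4 : r₁ % 4 = r₂ % 4) :
    ZMod.χ₄ (r₁ : ZMod 4) * (J((r₂ : ℤ) | r₁) * J((r₁ : ℤ) | r₂)) = 1 := by
  have hgcd : ((r₁ : ℤ)).gcd (r₂ : ℤ) = 1 := by
    rw [Int.gcd_natCast_natCast]; exact hcop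
  have hsq : J((r₁ : ℤ) | r₂) * J((r₁ : ℤ) | r₂) = 1 := by
    rw [← sq]; exact jacobiSym.sq_one hgcd
  rw [jacobiSym.quadratic_reciprocity' hr₂ hr₁, mul_assoc, hsq, mul_one]
  -- `χ₄(r₁) · qrSign r₁ r₂ = 1`
  simp only [qrSign]
  have hr1' : r₁ % 4 = 1 ∨ r₁ % 4 = 3 := by rcases hr₁ with ⟨k, rfl⟩; omega
  rcases hr1' with h1 | h3
  · rw [ZMod.χ₄_nat_one_mod_four h1]
    simp
  · rw [ZMod.χ₄_nat_three_mod_four h3]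
    have h3' : r₂ % 4 = 3 := by rw [← h4]; exact h3
    rw [jacobiSym.at_neg_one hr₂, ZMod.χ₄_nat_three_mod_four h3']
    norm_num

/-- **The complementary-divisor flip, core identity**: for coprime odd `r₁ ≡ r₂ (mod 4)` with
`(s₁, r₁) = (s₂, r₂) = 1` and `N = |r₁s₂ − r₂s₁|` (written additively over `ℕ`),
`(N/(r₁r₂)) = (s₁/r₁)(s₂/r₂)`. [cite: FriedlanderIwaniecAnnals1998, §12, before (12.10)] -/
theorem jacobiSym_absDet_eq {r₁ r₂ s₁ s₂ N : ℕ} (hr₁ : Odd r₁) (hr₂ : Odd r₂) (hcop : r₁.Coprime r₂)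
    (h4 : r₁ % 4 = r₂ % 4) (hN : r₁ * s₂ = r₂ * s₁ + N ∨ r₂ * s₁ = r₁ * s₂ + N) :
    J((N : ℤ) | r₁ * r₂) = J((s₁ : ℤ) | r₁) * J((s₂ : ℤ) | r₂) := by
  have hr₁0 : r₁ ≠ 0 := by rintro rfl; exact absurd hr₁ (by decide)
  have hr₂0 : r₂ ≠ 0 := by rintro rfl; exact absurd hr₂ (by decide)
  have hkey := χ₄_mul_jacobiSym_mul_jacobiSym_eq_one hr₁ hr₂ hcop h4
  have hχ : ZMod.χ₄ (r₂ : ZMod 4) = ZMod.χ₄ (r₁ : ZMod 4) := by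
    rw [ZMod.χ₄_nat_mod_four r₂, ZMod.χ₄_nat_mod_four r₁, h4]
  rw [jacobiSym.mul_right' _ hr₁0 hr₂0]
  rcases hN with hA | hB
  · -- `N = r₁ s₂ − r₂ s₁`: `N ≡ −r₂s₁ (mod r₁)`, `N ≡ r₁ s₂ (mod r₂)`
    have hA' : (N : ℤ) = r₁ * s₂ - r₂ * s₁ := by
      have := congrArg (fun x : ℕ => (x : ℤ)) hA; push_cast at this; linarith
    have h1 : J((N : ℤ) | r₁) = J(-((r₂ : ℤ) * s₁) | r₁) :=
      jacobiSym.mod_left' ((Int.modEq_iff_dvd).2 ⟨-(s₂ : ℤ), by rw [hA']; ring⟩)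
    have h2 : J((N : ℤ) | r₂) = J((r₁ : ℤ) * s₂ | r₂) :=
      jacobiSym.mod_left' ((Int.modEq_iff_dvd).2 ⟨(s₁ : ℤ), by rw [hA']; ring⟩)
    rw [h1, h2, jacobiSym.neg _ hr₁, jacobiSym.mul_left, jacobiSym.mul_left]
    calc ZMod.χ₄ (r₁ : ZMod 4) * (J((r₂ : ℤ) | r₁) * J((s₁ : ℤ) | r₁)) * (J((r₁ : ℤ) | r₂) * J((s₂ : ℤ) | r₂))
        = (ZMod.χ₄ (r₁ : ZMod 4) * (J((r₂ : ℤ) | r₁) * J((r₁ : ℤ) | r₂))) *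
            (J((s₁ : ℤ) | r₁) * J((s₂ : ℤ) | r₂)) := by ring
      _ = _ := by rw [hkey, one_mul]
  · -- `N = r₂ s₁ − r₁ s₂`: `N ≡ r₂s₁ (mod r₁)`, `N ≡ −r₁ s₂ (mod r₂)`
    have hB' : (N : ℤ) = r₂ * s₁ - r₁ * s₂ := by
      have := congrArg (fun x : ℕ => (x : ℤ)) hB; push_cast at this; linarith
    have h1 : J((N : ℤ) | r₁) = J((r₂ : ℤ) * s₁ | r₁) :=
      jacobiSym.mod_left' ((Int.modEq_iff_dvd).2 ⟨(s₂ : ℤ), by rw [hB']; ring⟩)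
    have h2 : J((N : ℤ) | r₂) = J(-((r₁ : ℤ) * s₂) | r₂) :=
      jacobiSym.mod_left' ((Int.modEq_iff_dvd).2 ⟨-(s₁ : ℤ), by rw [hB']; ring⟩)
    rw [h1, h2, jacobiSym.neg _ hr₂, jacobiSym.mul_left, jacobiSym.mul_left, hχ]
    calc J((r₂ : ℤ) | r₁) * J((s₁ : ℤ) | r₁) * (ZMod.χ₄ (r₁ : ZMod 4) * (J((r₁ : ℤ) | r₂) * J((s₂ : ℤ) | r₂)))
        = (ZMod.χ₄ (r₁ : ZMod 4) * (J((r₂ : ℤ) | r₁) * J((r₁ : ℤ) | r₂))) *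
            (J((s₁ : ℤ) | r₁) * J((s₂ : ℤ) | r₂)) := by ring
      _ = _ := by rw [hkey, one_mul]

/-- If `N = |r₁s₂ − r₂s₁| = t·q` with `(r₁, r₂) = 1`, `(rᵢ, sᵢ) = 1`, then `(q, r₁r₂) = 1`. [folklore] -/
private theorem coprime_of_absDet {r₁ r₂ s₁ s₂ N t q : ℕ} (hcop : r₁.Coprime r₂)
    (hs₁ : s₁.Coprime r₁) (hs₂ : s₂.Coprime r₂)
    (hN : r₁ * s₂ = r₂ * s₁ + N ∨ r₂ * s₁ = r₁ * s₂ + N) (hq : N = t * q) :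
    q.Coprime (r₁ * r₂) := by
  rw [Nat.coprime_mul_iff_right]
  have hqN : q ∣ N := ⟨t, by rw [hq, mul_comm]⟩
  constructor
  · refine Nat.coprime_of_dvd fun p hp hpq hpr => ?_
    have hpN : p ∣ N := dvd_trans hpq hqN
    have hprs : p ∣ r₂ * s₁ := by
      rcases hN with h | h
      · have : p ∣ r₂ * s₁ + N := h ▸ dvd_mul_of_dvd_left hpr _
        exact (Nat.dvd_add_right hpN).1 (by rwa [add_comm] at this)
      · rw [h]; exact dvd_add (dvd_mul_of_dvd_left hpr _) hpN
    rcases (Nat.Prime.dvd_mul hp).1 hprs with h2 | h2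
    · exact absurd ((Nat.Coprime.coprime_dvd_left hpr hcop).eq_one_of_dvd h2) hp.one_lt.ne'
    · exact absurd ((Nat.Coprime.coprime_dvd_left h2 hs₁).eq_one_of_dvd hpr) hp.one_lt.ne'
  · refine Nat.coprime_of_dvd fun p hp hpq hpr => ?_
    have hpN : p ∣ N := dvd_trans hpq hqN
    have hprs : p ∣ r₁ * s₂ := by
      rcases hN with h | h
      · rw [h]; exact dvd_add (dvd_mul_of_dvd_left hpr _) hpN
      · have : p ∣ r₁ * s₂ + N := h ▸ dvd_mul_of_dvd_left hpr _
        exact (Nat.dvd_add_right hpN).1 (by rwa [add_comm] at this)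
    rcases (Nat.Prime.dvd_mul hp).1 hprs with h2 | h2
    · exact absurd ((Nat.Coprime.coprime_dvd_left hpr hcop.symm).eq_one_of_dvd h2) hp.one_lt.ne'
    · exact absurd ((Nat.Coprime.coprime_dvd_left h2 hs₂).eq_one_of_dvd hpr) hp.one_lt.ne'

/-- **FI's complementary-divisor identity** [FI, §12, before (12.10)]: for `r₁, r₂` coprime, odd,
`r₁ ≡ r₂ (mod 4)` (in the source: mod 8), `(r₁, s₁) = (r₂, s₂) = 1` ((12.1)) and `|r₁s₂ − r₂s₁| = dmq`:
`(dm/(r₁r₂)) = (s₁/r₁)(s₂/r₂)(q/(r₁r₂))`. [cite: FriedlanderIwaniecAnnals1998, §12, before (12.10)] -/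
theorem jacobiSym_complementary_divisor {r₁ r₂ s₁ s₂ d m q : ℕ} (hr₁ : Odd r₁) (hr₂ : Odd r₂)
    (hcop : r₁.Coprime r₂) (h4 : r₁ % 4 = r₂ % 4) (hs₁ : s₁.Coprime r₁) (hs₂ : s₂.Coprime r₂)
    (hN : r₁ * s₂ = r₂ * s₁ + d * m * q ∨ r₂ * s₁ = r₁ * s₂ + d * m * q) :
    J(((d * m : ℕ) : ℤ) | r₁ * r₂) =
      J((s₁ : ℤ) | r₁) * J((s₂ : ℤ) | r₂) * J((q : ℤ) | r₁ * r₂) := by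
  have hcore := jacobiSym_absDet_eq hr₁ hr₂ hcop h4 hN
  have hq : q.Coprime (r₁ * r₂) := coprime_of_absDet hcop hs₁ hs₂ hN rfl
  have hgcd : ((q : ℤ)).gcd ((r₁ * r₂ : ℕ) : ℤ) = 1 := by
    rw [Int.gcd_natCast_natCast]; exact hq
  have hsq : J((q : ℤ) | r₁ * r₂) * J((q : ℤ) | r₁ * r₂) = 1 := by
    rw [← sq]
    have := jacobiSym.sq_one (b := r₁ * r₂) hgcd
    exact_mod_cast this
  have hsplit : J((((d * m * q : ℕ)) : ℤ) | r₁ * r₂) =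
      J(((d * m : ℕ) : ℤ) | r₁ * r₂) * J((q : ℤ) | r₁ * r₂) := by
    rw [show (((d * m * q : ℕ)) : ℤ) = ((d * m : ℕ) : ℤ) * (q : ℤ) by push_cast; ring,
      jacobiSym.mul_left]
  rw [hsplit] at hcore
  calc J(((d * m : ℕ) : ℤ) | r₁ * r₂)
      = J(((d * m : ℕ) : ℤ) | r₁ * r₂) * (J((q : ℤ) | r₁ * r₂) * J((q : ℤ) | r₁ * r₂)) := by
        rw [hsq, mul_one]
    _ = (J(((d * m : ℕ) : ℤ) | r₁ * r₂) * J((q : ℤ) | r₁ * r₂)) * J((q : ℤ) | r₁ * r₂) := by ring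
    _ = _ := by rw [hcore]

end Literature.NumberTheory.Sieve.FriedlanderIwaniecPrimes

end
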